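import Summits.Langlands.Langlands.Theses.SenNullAlignment

/-!
# `SenNullAlignment.SectorComplement` (stmt-Langlands-16308) — logical position (SUSPECT-EQUIVALENCE audit)

Crux-strategist unit `cstrat-stmt-Langlands-16308-q1` (2026-08-17). The payload witness
`Theorems.skinnerWilesDefectOne_sectorComplement_iff_of_target` concerns the HOMONYMOUS frame item of route
SkinnerWilesDefectOne (`ReducibleOrdinaryModular → Langlands`, stmt-Langlands-12923), a different statement;
this file records the identical position for THIS route's frame
`SectorComplement : Prop := OddHilbertReciprocity → _root_.Langlands`, kernel-checked, together with ONE
fact that is special to this route: its target `OddHilbertReciprocity` (direction (A) of the summit for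
`n = 2` over totally real `K` on the totally-odd holomorphic Hilbert plane, `∃ RD`) is a FORMAL COROLLARY of
the summit (`Langlands` gives `Nonempty (ReciprocityData K)` and (A) for every `𝓡`, every `n > 0`, every
L-algebraic cuspidal `π`; the extra hypotheses of the target are simply not used), so the bookkeeping identity
`Langlands ↔ OddHilbertReciprocity ∧ SectorComplement` holds here by pure logic — the route is literally the
bridge split `X ∧ (X → S)` of the summit with `X` strictly on the odd-Hilbert plane.

* `sna_sectorComplement_of_langlands`: `Langlands → SectorComplement`;
* `sna_sectorComplement_iff_of_target`: under the route target, `SectorComplement ↔ Langlands` (the suspect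
  equivalence, verbatim);
* `sna_oddHilbertReciprocity_of_cruxes`: the target from the six other binders of `closes` (the inner logic of
  the route's deciding theorem, restated so that the next item can be stated);
* `sna_sectorComplement_iff_of_cruxes`: under the six other binders of `closes`, `SectorComplement ↔ Langlands`;
* `sna_oddHilbertReciprocity_of_langlands`: `Langlands → OddHilbertReciprocity` (the target is a consequence of
  the summit);
* `sna_langlands_iff_target_and_sectorComplement`: `Langlands ↔ OddHilbertReciprocity ∧ SectorComplement`;
* `sna_not_sectorComplement_iff`: `¬ SectorComplement ↔ OddHilbertReciprocity ∧ ¬ Langlands`;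
* `sna_sectorComplement_iff_not_or`: truth table.

Verdict of the audit (EQUIVALENCE-AUDIT_SenNullAlignment.md): equivalence-benign — no item of the route is
proved; the binders the equivalence is conditional on are open and refuter-vetted; the frame is the honest rest
of the summit and is never staffed from this route.
-/

set_option linter.dupNamespace false

namespace Summit.Langlands.Langlands.Cruxes.SectorComplement.EquivalenceAuditSNA

open Summit.Langlands.Langlands.Theses.SenNullAlignment

/-- The frame is implied by the summit (discard the sector hypothesis). [folklore] -/
theorem sna_sectorComplement_of_langlands : _root_.Langlands → SectorComplement :=
  fun h _ ↦ h

/-- Under the route target `OddHilbertReciprocity` the frame IS the summit. [folklore] -/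
theorem sna_sectorComplement_iff_of_target (hX : OddHilbertReciprocity) :
    SectorComplement ↔ _root_.Langlands :=
  ⟨fun hC ↦ hC hX, fun h _ ↦ h⟩

/-- The target from the six other binders of the deciding theorem `closes` — its inner logic, restated (place
by place: `v ∤ ℓ` → `AwayFromEll`; `v ∣ ℓ` fully aligned → `SingularProjectiveFinite` then `AlignedAtEll`;
`v ∣ ℓ` not aligned → `NonAlignedAtEll`; no weight-one embedding → the inlined weight is regular and
`RegularServed` applies). [folklore] -/
theorem sna_oddHilbertReciprocity_of_cruxes (h1 : SingularProjectiveFinite) (h2 : NonAlignedAtEll)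
    (h3 : AlignedAtEll) (h4 : AwayFromEll) (hA : OddNonRegularAttached) (hR : RegularServed) :
    OddHilbertReciprocity := by
  intro K _ _ hK
  obtain ⟨RD, hreg⟩ := hR K hK
  refine ⟨RD, ?_⟩
  intro hcpt π k w hL hhol hodd ℓ _ ι
  by_cases hne : ∃ β : K →+* ℂ, k β = 1
  · obtain ⟨ρ, hirr, hae⟩ := hA K hK hcpt π k w hL hhol hodd hne ℓ ι
    have hplace : ∀ v : IsDedekindDomain.HeightOneSpectrum (NumberField.RingOfIntegers K),
        Summit.Langlands.LocalGlobalCompatibleAt RD ι π.1 ρ v ∧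
          ∀ hv : ((ℓ : ℕ) : NumberField.RingOfIntegers K) ∈ v.asIdeal,
            (RD.pst ℓ v hv).IsDeRhamFramed (ρ.toLocal v) := by
      intro v
      by_cases hv : ((ℓ : ℕ) : NumberField.RingOfIntegers K) ∈ v.asIdeal
      · by_cases hal : (∀ τ : K →+* PadicAlgCl ℓ,
            (∀ x : NumberField.RingOfIntegers K, x ∈ v.asIdeal → ‖τ x‖ < 1) →
              k ((ι : PadicAlgCl ℓ →+* ℂ).comp τ) = 1)
        · have h := h3 K hK RD hreg hcpt π k w hL hhol hodd hne ℓ ι ρ hirr hae v hv hal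
            (h1 K hK hcpt π k w hL hhol hodd hne ℓ ι ρ hirr hae v hv hal)
          exact ⟨h.1, fun _ => h.2⟩
        · have h := h2 K hK RD hreg hcpt π k w hL hhol hodd hne ℓ ι ρ hirr hae v hv hal
          exact ⟨h.1, fun _ => h.2⟩
      · exact ⟨h4 K hK RD hreg hcpt π k w hL hhol hodd hne ℓ ι ρ hirr hae v hv,
          fun hv' => absurd hv' hv⟩
    refine ⟨ρ, hirr, ⟨hae.mono fun v hv => ?_, fun v hv => (hplace v).2 hv⟩, hae,
      fun v => (hplace v).1⟩
    obtain ⟨α, -, hur, -⟩ := hv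
    exact hur
  · have hregT : ∃ T : Literature.NumberTheory.Automorphic.InfinityType K 2,
        π.1.HasInfinityType T ∧ T.IsRegular := by
      refine ⟨_, hhol, ?_⟩
      intro β
      simp only [Multiset.insert_eq_cons, Multiset.map_cons, Multiset.map_singleton,
        Literature.NumberTheory.Automorphic.ArchWeight.swap_a, Multiset.nodup_cons,
        Multiset.mem_singleton, Multiset.nodup_singleton, and_true]
      intro h
      have h1 : ((k β : ℕ) : ℂ) = 1 := by linear_combination h
      exact hne ⟨β, by exact_mod_cast h1⟩
    obtain ⟨ρ, hirr, hgeo, hcorr⟩ := hreg hcpt π hL hregT ℓ ι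
    exact ⟨ρ, hirr, hgeo, hcorr⟩

/-- Under the six other binders of `closes` the frame is the summit. [folklore] -/
theorem sna_sectorComplement_iff_of_cruxes (h1 : SingularProjectiveFinite) (h2 : NonAlignedAtEll)
    (h3 : AlignedAtEll) (h4 : AwayFromEll) (hA : OddNonRegularAttached) (hR : RegularServed) :
    SectorComplement ↔ _root_.Langlands :=
  sna_sectorComplement_iff_of_target (sna_oddHilbertReciprocity_of_cruxes h1 h2 h3 h4 hA hR)

/-- **The target is a formal corollary of the summit**: `Langlands → OddHilbertReciprocity` — take `RD` from
the non-vacuity conjunct `Nonempty (ReciprocityData K)` and apply direction (A) at `n = 2`; the holomorphy and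
oddness hypotheses of the target are not used. [folklore] -/
theorem sna_oddHilbertReciprocity_of_langlands : _root_.Langlands → OddHilbertReciprocity := by
  intro h K _ _ _hK
  obtain ⟨⟨RD⟩, hall⟩ := h K
  refine ⟨RD, ?_⟩
  intro hcpt π k w hL _hhol _hodd ℓ _ ι
  obtain ⟨ρ, hirr, hgeo, hcorr, -⟩ := (hall RD 2 two_pos hcpt).1 π hL ℓ ι
  exact ⟨ρ, hirr, hgeo, hcorr⟩

/-- Hence the exact bookkeeping identity: the route is the bridge split `X ∧ (X → S)` of the summit with
`X = OddHilbertReciprocity`. [folklore] -/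
theorem sna_langlands_iff_target_and_sectorComplement :
    _root_.Langlands ↔ OddHilbertReciprocity ∧ SectorComplement :=
  ⟨fun h ↦ ⟨sna_oddHilbertReciprocity_of_langlands h, fun _ ↦ h⟩, fun h ↦ h.2 h.1⟩

/-- Exact content of a refutation of the frame: prove the (open) sector theorem AND disprove the formal
summit. [folklore] -/
theorem sna_not_sectorComplement_iff :
    ¬ SectorComplement ↔ OddHilbertReciprocity ∧ ¬ _root_.Langlands :=
  Classical.not_imp

/-- Any refutation of the frame is a disproof of the formal summit. [folklore] -/
theorem sna_not_langlands_of_not_sectorComplement : ¬ SectorComplement → ¬ _root_.Langlands :=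
  fun h ↦ (sna_not_sectorComplement_iff.1 h).2

/-- Truth table of the frame. [folklore] -/
theorem sna_sectorComplement_iff_not_or :
    SectorComplement ↔ ¬ OddHilbertReciprocity ∨ _root_.Langlands :=
  imp_iff_not_or

end Summit.Langlands.Langlands.Cruxes.SectorComplement.EquivalenceAuditSNA
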